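import Mathlib
import HarnessLib

/-!
# SqLabelledBoxSum

Topic `Literature/Uncategorized`. Named literature fact(s) relocated by the gate from `Summits/HodgeConjecture/HodgeConjecture/Theorems/F0P3cDyRamSqLabelledBoxSumDefs.lean`
(accept-time relocation of `[cite]`d propositions written inline in a Summits proposal; human ruling 2026-08-15).
Sources: Kottwitz1986BaseChangeUnits, Rogawski1990.

* `Literature.Uncategorized.SqLabelledBoxSum`
-/

namespace Literature.Uncategorized

open Finset

/-- **`SqLabelledBoxSum` — THE TRUNCATED LABELLED κ-BOX-SUM OF THE SQUARE TRUNK (brick (c), an arithmetic Prop).**  ★ p856906 `sum_box_kappa_eq_typeZero`'s statement with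
the fence `2d ≤ nᵢ + 1`, the glue-foot ∕ hanging truncation `2ρ + (d%2 + 2d) ≤ 2·n_plane + 1`, and the right-hand side `SIGN·(q^{k−(d+1)∕2} − q^{k−max((d+1)∕2, B)})`.  Pure
finite-sum bookkeeping over `ℚ` (no lattices). [cite: Kottwitz1986BaseChangeUnits, §1 pp. 240–241] [cite: Rogawski1990, §4.9 Prop. 4.9.1 (a) p. 55; §4.10 p. 58] -/
def SqLabelledBoxSum : Prop :=
  ∀ (q : ℕ) {d n₁ n₂ n₃ Bx k : ℕ} (hd : 2 ≤ d)
    (hiso : (n₁ = n₂ ∧ n₁ ≤ n₃) ∨ (n₁ = n₃ ∧ n₁ ≤ n₂) ∨ (n₂ = n₃ ∧ n₂ ≤ n₁))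
    (hfence : 2 * d ≤ n₁ + 1 ∧ 2 * d ≤ n₂ + 1 ∧ 2 * d ≤ n₃ + 1) (h1 : n₁ % 2 = d % 2) (h2 : n₂ % 2 = d % 2) (h3 : n₃ % 2 = d % 2) (hBx : n₁ + n₂ + n₃ ≤ Bx)
    (hk : 2 * k + d = n₁ + n₂ + n₃ + 2) (i : Fin 3) (ω εH : ℚ) (εG : Fin 3 → Fin 3 → ℚ)
    (hω0 : i = 0 → n₂ = n₃ → n₂ + 2 * d ≤ n₁ → εG 0 0 = ω) (hω1 : i = 1 → n₁ = n₃ → n₁ + 2 * d ≤ n₂ → εG 1 1 = ω)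
    (hω2 : i = 2 → n₁ = n₂ → n₁ + 2 * d ≤ n₃ → εG 2 2 = ω)
    (v : (Fin 3 → ℕ) → ℚ) (hcore : v ![0, 0, 0] = 0)
    (hT1 : ∀ s, 1 ≤ s → v ![0, s, s] = if i = 0 ∧ 2 * d ≤ s ∧ 2 ∣ s ∧ s ≤ n₁ then ω * (q : ℚ) ^ (s / 2) else 0)
    (hT2 : ∀ s, 1 ≤ s → v ![s, 0, s] = if i = 1 ∧ 2 * d ≤ s ∧ 2 ∣ s ∧ s ≤ n₂ then ω * (q : ℚ) ^ (s / 2) else 0)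
    (hT3 : ∀ s, 1 ≤ s → v ![s, s, 0] = if i = 2 ∧ 2 * d ≤ s ∧ 2 ∣ s ∧ s ≤ n₃ then ω * (q : ℚ) ^ (s / 2) else 0)
    (hG1 : ∀ ρ s, 1 ≤ ρ → 1 ≤ s → v ![2 * ρ, 2 * ρ + s, 2 * ρ + s] =
      (if 2 ∣ s ∧ 2 * ρ ≤ min n₂ n₃ ∧ 2 * ρ + s ≤ n₁ then
          (![ω * (q : ℚ) ^ (2 * ρ + s / 2 - 1) * ((if 2 * d ≤ s then (q : ℚ) - 1 else 0) - (if s + 2 = 2 * d then 1 else 0)), 0, 0] : Fin 3 → ℚ) i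
        else 0) +
      (if 2 ∣ s ∧ n₂ = n₃ ∧ n₁ = n₂ + s ∧ n₂ < 2 * ρ ∧ 2 * ρ - n₂ ≤ n₂ - d + 1 ∧ 2 * ρ + (d % 2 + 2 * d) ≤ 2 * n₂ + 1 then
          (![if 2 * d ≤ s + 2 * ((2 * ρ - n₂ + 1) / 2) then εG 0 0 else 0,
             if d ≤ (2 * ρ - n₂ + 1) / 2 then εG 0 1 else 0,
             if d ≤ (2 * ρ - n₂ + 1) / 2 then εG 0 2 else 0] : Fin 3 → ℚ) i * (q : ℚ) ^ (2 * ρ + s / 2 - (2 * ρ - n₂ + 1) / 2)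
        else 0))
    (hG2 : ∀ ρ s, 1 ≤ ρ → 1 ≤ s → v ![2 * ρ + s, 2 * ρ, 2 * ρ + s] =
      (if 2 ∣ s ∧ 2 * ρ ≤ min n₁ n₃ ∧ 2 * ρ + s ≤ n₂ then
          (![0, ω * (q : ℚ) ^ (2 * ρ + s / 2 - 1) * ((if 2 * d ≤ s then (q : ℚ) - 1 else 0) - (if s + 2 = 2 * d then 1 else 0)), 0] : Fin 3 → ℚ) i
        else 0) +
      (if 2 ∣ s ∧ n₁ = n₃ ∧ n₂ = n₁ + s ∧ n₁ < 2 * ρ ∧ 2 * ρ - n₁ ≤ n₁ - d + 1 ∧ 2 * ρ + (d % 2 + 2 * d) ≤ 2 * n₁ + 1 then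
          (![if d ≤ (2 * ρ - n₁ + 1) / 2 then εG 1 0 else 0,
             if 2 * d ≤ s + 2 * ((2 * ρ - n₁ + 1) / 2) then εG 1 1 else 0,
             if d ≤ (2 * ρ - n₁ + 1) / 2 then εG 1 2 else 0] : Fin 3 → ℚ) i * (q : ℚ) ^ (2 * ρ + s / 2 - (2 * ρ - n₁ + 1) / 2)
        else 0))
    (hG3 : ∀ ρ s, 1 ≤ ρ → 1 ≤ s → v ![2 * ρ + s, 2 * ρ + s, 2 * ρ] =
      (if 2 ∣ s ∧ 2 * ρ ≤ min n₁ n₂ ∧ 2 * ρ + s ≤ n₃ then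
          (![0, 0, ω * (q : ℚ) ^ (2 * ρ + s / 2 - 1) * ((if 2 * d ≤ s then (q : ℚ) - 1 else 0) - (if s + 2 = 2 * d then 1 else 0))] : Fin 3 → ℚ) i
        else 0) +
      (if 2 ∣ s ∧ n₁ = n₂ ∧ n₃ = n₁ + s ∧ n₁ < 2 * ρ ∧ 2 * ρ - n₁ ≤ n₁ - d + 1 ∧ 2 * ρ + (d % 2 + 2 * d) ≤ 2 * n₁ + 1 then
          (![if d ≤ (2 * ρ - n₁ + 1) / 2 then εG 2 0 else 0,
             if d ≤ (2 * ρ - n₁ + 1) / 2 then εG 2 1 else 0,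
             if 2 * d ≤ s + 2 * ((2 * ρ - n₁ + 1) / 2) then εG 2 2 else 0] : Fin 3 → ℚ) i * (q : ℚ) ^ (2 * ρ + s / 2 - (2 * ρ - n₁ + 1) / 2)
        else 0))
    (hH : ∀ ρ, 1 ≤ ρ → v ![2 * ρ, 2 * ρ, 2 * ρ] =
      if n₁ = n₂ ∧ n₂ = n₃ ∧ n₁ < 2 * ρ ∧ 2 * ρ - n₁ ≤ n₁ - d + 1 ∧ d ≤ (2 * ρ - n₁ + 1) / 2 ∧ 2 * ρ + (d % 2 + 2 * d) ≤ 2 * n₁ + 1 then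
        εH * (q : ℚ) ^ (2 * ρ - (2 * ρ - n₁ + 1) / 2) else 0)
    (hzero : ∀ a : Fin 3 → ℕ, ¬ ((a = ![0, 0, 0]) ∨
      (∃ s, 2 ∣ s ∧ 2 ≤ s ∧ (a = ![0, s, s] ∨ a = ![s, 0, s] ∨ a = ![s, s, 0])) ∨
      (∃ ρ s, 1 ≤ ρ ∧ 2 ∣ s ∧ 2 ≤ s ∧ (a = ![2 * ρ, 2 * ρ + s, 2 * ρ + s] ∨ a = ![2 * ρ + s, 2 * ρ, 2 * ρ + s] ∨ a = ![2 * ρ + s, 2 * ρ + s, 2 * ρ])) ∨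
      (∃ ρ, 1 ≤ ρ ∧ a = ![2 * ρ, 2 * ρ, 2 * ρ])) → v a = 0),
    ((q : ℚ) - 1) * ∑ a : Fin 3 → Fin (Bx + 1), v (fun j => (a j : ℕ)) =
      (if n₁ = n₂ ∧ n₂ = n₃ then εH else if n₂ = n₃ then εG 0 i else if n₁ = n₃ then εG 1 i else εG 2 i) *
        ((q : ℚ) ^ (k - (d + 1) / 2) - (q : ℚ) ^ (k - max ((d + 1) / 2) ((((![n₁, n₂, n₃] : Fin 3 → ℕ) i + 2 * (d % 2) + 2 - 3 * d) / 2))))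

end Literature.Uncategorized
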